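import Summits.QuantumFields.YangMills.Theorems.GradientFlowWitnessFlowedResponseFloorUnitPinning
import Summits.QuantumFields.YangMills.Theorems.BalabanLadderIRAfOnsetLatticeAF
import HarnessLib

/-!
# Route `GradientFlowWitness`, crux `FlowedResponseFloor` (stmt-QuantumFields-25684): WHERE THE TWO STUBS OF THE BC3
# SPLIT HAVE CONTENT — the flowed response is `O(a(β)⁻⁸ log β/β)` UNIFORMLY IN THE VOLUME, so on every «slow» unit
# (`(1 + log β)/(β a(β)⁸) → 0`) the finite-size stub holds for free and the window stub fails (hypothesis-free,
# every compact `G`)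

Helper file of the prover seat `ym-line-gfw-p1` (gen 3), `--supports stmt-QuantumFields-25684`, R3/RECORD framing.
The registered skeleton of the deciding crux `Summit.QuantumFields.YangMills.Theses.GradientFlowWitness.FlowedResponseFloor`
(`Cruxes/FlowedResponseFloor/Lines/birth.lean`) has two stubs over the landed vocabulary
`Theorems/GradientFlowWitnessFlowedResponseFloorDefs`: `stub_window : FlowedResponseFloorWindow` (a floor
`ε₁ ≤ |resp|` on tori of bounded size in units `a(β)`) and `stub_finiteSize : FlowedResponseFiniteSize` (β-uniform
Cauchy control of `L ↦ resp(β, L)` beyond `a(β)L ≥ Λ₆`, for EVERY unit `a`).  The sequel files `…WeakCoupling` /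
`…UnitPinning` (gen 2) proved `|resp(β, L)| ≤ K(2L+1)⁸(1 + log β)/β` and deduced that a unit carrying the window floor
has `a(β)⁸ ≤ C(1 + log β)/β`.  This file removes the volume from the ceiling and reads off what that says about BOTH stubs:

* `abs_probe_le_sum`, `abs_leg_sub_le_sum`, `torusE_abs_leg_sub_le_sum` — the probe and the leg deviation are bounded by
  the lattice Riemann sums `Σ_x |w(a x)|`, `Σ_y |v(a y)|·(6N − dens_y)` instead of by site counting;
* **`abs_resp_le_weakCoupling_unif`** — `|resp G r a ρ₀ w v β L| ≤ K · min(a(β),1)⁻⁸ · (1 + log β)/β` for ALL odd tori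
  `2L+1 ≥ 3`, all `β ≥ 1`, every unit (`K = K(G, r, ρ₀, w, v)`; Schwartz lattice sums `Σ_{x ∈ ℤ⁴}|f(a x)| ≤ K_f/min(a,1)⁴`,
  tree `AfOnset.exists_sum_abs_schwartz_lattice_le_div_min`, and the volume-uniform mean-plaquette budget
  `CouplingSumRule.exists_six_mul_sub_torusE_dens_le`) — the gen-2 ceiling WITHOUT the factor `(2L+1)⁸`;
* **`abs_resp_le_of_slowUnit`** — on a slow unit the response is eventually `≤ η` SIMULTANEOUSLY ON ALL TORI;
* **`finiteSize_of_slowUnit`** — hence the conclusion of `FlowedResponseFiniteSize` holds for every slow unit (with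
  `Λ₆ = 1`): the finite-size stub («W2 typed once», quantified over ALL units) has content only on the units that are NOT
  slow (`liminf β a(β)⁸/(1 + log β) < ∞`) — a class containing every unit pinned by `unit_pow_le_of_windowFloor`
  (`limsup β a(β)⁸/(1 + log β) ≤ C`), i.e. every unit on which the window stub can hold;
* **`windowFloor_false_of_slowUnit`** — and no slow unit carries the window-floor data of `stub_window` (the gen-2
  pinning, contrapositive form); `isSlowUnit_rpow` — every power law `β^{-c}`, `c < 1/8`, is slow.

So, in the kernel: on slow units BOTH registered stubs are trivial (the window floor is unfulfillable, the finite-size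
control is automatic), and both keep all their content on the complement (units within `((1 + log β)/β)^{1/8}` of zero up
to constants along a subsequence — where the physical `a ≍ e^{−β/(4Nb₀)}` lives); neither stub is moved there by anything
in the tree.  HONEST FRAMING: ceilings and their bookkeeping only — nothing here is a floor; `stub_window`, `stub_finiteSize` (as
registered: ALL units), `FlowedResponseFloor`, `BalabanLadder.NT`, the OS legs and the Yang–Mills mass gap are NOT proved
or claimed.  Refs: Lüscher, JHEP 08 (2010) 071 (flowed energy); the weak-coupling mean-plaquette law via the tree
(Chatterjee arXiv:1602.01222 Thm 2.1 as typed in `AfOnset`).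
-/

set_option autoImplicit false

noncomputable section

open scoped BigOperators Topology
open Filter MeasureTheory
open Literature.MathematicalPhysics.QuantumFieldTheory hiding ZdEdge
open Literature.MathematicalPhysics.QuantumLattice
open Literature.Probability.LatticeModels (box mem_box card_box)
open Summit.QuantumFields.YangMills.Cruxes.OSLegsFromFemtoAndGap.DlrCollarTransfer
open Summit.QuantumFields.YangMills.Cruxes.NT.ConjugateResponse (torusE_comp_cfgReflect)
open Summit.QuantumFields.YangMills.Cruxes.NT.CouplingSumRule (exists_six_mul_sub_torusE_dens_le)
open Summit.QuantumFields.YangMills.Cruxes.NT.MarkovMirror (continuous_cfgReflect)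
open Summit.QuantumFields.YangMills.Cruxes.UVSeamRec.ResponsePinning (torusE_mono torusE_const torusE_add'
  torusE_const_mul')
open Summit.QuantumFields.YangMills.Cruxes.IR.AfOnset (exists_sum_abs_schwartz_lattice_le_div_min)

namespace Summit.QuantumFields.YangMills.Cruxes.FlowedResponseFloor.WindowSplit

/-! ## §1 Riemann-sum bounds on the probe and on the leg deviation -/

section Sums

variable {G : Type} [Group G] [TopologicalSpace G]

/-- **Riemann-sum bound on the flowed probe**: `|X̂_w(U)| ≤ ρ₀⁴ · 64N · Σ_{x ∈ box L} |w(a(β) x)|` (flow unitarity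
`|E_t(x)| ≤ 64N`, tree `abs_flowedEnergy_le`; no site counting). -/
theorem abs_probe_le_sum (r : LatticeRep G) (a : ℝ → ℝ) (ρ₀ : ℝ) (w : SchwartzMap (EuclideanSpace ℝ (Fin 4)) ℝ)
    (β : ℝ) (L : ℕ) (U : LGConfig 4 G) :
    |probe G r a ρ₀ w β L U| ≤ ρ₀ ^ 4 * (64 * r.N) * ∑ x ∈ box 4 L, |w (a β • siteToE x)| := by
  unfold probe
  refine (Finset.abs_sum_le_sum_abs _ _).trans ?_
  rw [Finset.mul_sum]
  refine Finset.sum_le_sum fun x _ => ?_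
  have h := abs_flowedEnergy_le r.ρ r.mem_unitary ((ρ₀ / a β) ^ 2)
    (fun i => ((x i : ℤ) : ZMod (2 * L + 1))) (mirrorDouble G L U)
  rw [abs_mul, abs_mul, abs_of_nonneg (by positivity : (0 : ℝ) ≤ ρ₀ ^ 4)]
  calc |w (a β • siteToE x)| * (ρ₀ ^ 4 *
        |flowedEnergy r.ρ ((ρ₀ / a β) ^ 2) (fun i => ((x i : ℤ) : ZMod (2 * L + 1))) (mirrorDouble G L U)|)
      ≤ |w (a β • siteToE x)| * (ρ₀ ^ 4 * (64 * r.N)) :=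
        mul_le_mul_of_nonneg_left (mul_le_mul_of_nonneg_left h (by positivity)) (abs_nonneg _)
    _ = ρ₀ ^ 4 * (64 * r.N) * |w (a β • siteToE x)| := by ring

variable [IsTopologicalGroup G] [CompactSpace G] [MeasurableSpace G] [BorelSpace G]

/-- **Weighted deviation of the bare leg from its frozen value**:
`|Ṽ_v(U) − 6N Σ_y v(a y)| ≤ Σ_{y ∈ box L} |v(a y)| · (6N − dens_y U)` (each `6N − dens_y ≥ 0`). -/
theorem abs_leg_sub_le_sum (r : LatticeRep G) (a : ℝ → ℝ) (v : SchwartzMap (EuclideanSpace ℝ (Fin 4)) ℝ)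
    (β : ℝ) (L : ℕ) (U : LGConfig 4 G) :
    |leg G r a v β L U - 6 * r.N * ∑ y ∈ box 4 L, v (a β • siteToE y)| ≤
      ∑ y ∈ box 4 L, |v (a β • siteToE y)| * (6 * r.N - dens G r y U) := by
  unfold leg
  rw [Finset.mul_sum, ← Finset.sum_sub_distrib]
  refine (Finset.abs_sum_le_sum_abs _ _).trans (Finset.sum_le_sum fun y _ => le_of_eq ?_)
  have h0 : 0 ≤ 6 * (r.N : ℝ) - dens G r y U := sub_nonneg.2 (dens_le_six_mul r y U)
  have : v (a β • siteToE y) * dens G r y U - 6 * r.N * v (a β • siteToE y) =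
      -(v (a β • siteToE y) * (6 * r.N - dens G r y U)) := by ring
  rw [this, abs_neg, abs_mul, abs_of_nonneg h0]

end Sums

/-! ## §2 The volume-uniform ceiling -/

section Uniform

variable (G : Type) [Group G] [TopologicalSpace G] [IsTopologicalGroup G] [CompactSpace G]
  [MeasurableSpace G] [BorelSpace G] (r : LatticeRep G)

/-- **Mean weighted deviation of the bare leg**: `E_T|Ṽ_v − 6N Σ_y v(a y)| ≤ Σ_y |v(a y)| · (6N − E_T[dens_y])`. -/
theorem torusE_abs_leg_sub_le_sum (a : ℝ → ℝ) (v : SchwartzMap (EuclideanSpace ℝ (Fin 4)) ℝ) (β : ℝ) (L : ℕ) :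
    torusE G r β L (fun U => |leg G r a v β L U - 6 * r.N * ∑ y ∈ box 4 L, v (a β • siteToE y)|) ≤
      ∑ y ∈ box 4 L, |v (a β • siteToE y)| * (6 * r.N - torusE G r β L (dens G r y)) := by
  have hc1 : Continuous fun U => |leg G r a v β L U - 6 * r.N * ∑ y ∈ box 4 L, v (a β • siteToE y)| :=
    ((continuous_leg r a v β L).sub continuous_const).abs
  have hc2 : Continuous fun U => ∑ y ∈ box 4 L, |v (a β • siteToE y)| * (6 * (r.N : ℝ) - dens G r y U) :=
    continuous_finsetSum _ fun y _ => continuous_const.mul (continuous_const.sub (continuous_dens r y))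
  refine (torusE_mono r β L hc1 hc2 fun U => abs_leg_sub_le_sum r a v β L U).trans (le_of_eq ?_)
  rw [torusE_finset_sum G r β L (box 4 L) (fun y U => |v (a β • siteToE y)| * (6 * (r.N : ℝ) - dens G r y U))
    (fun y _ => continuous_const.mul (continuous_const.sub (continuous_dens r y)))]
  refine Finset.sum_congr rfl fun y _ => ?_
  rw [torusE_const_mul', torusE_const_sub G r β L _ (continuous_dens r y)]

/-- `1/min(a,1)⁸ ≤ 1 + 1/a⁸` for `a > 0`. [folklore] -/
theorem inv_min_pow_le {a : ℝ} (ha : 0 < a) : ((min a 1) ^ 8)⁻¹ ≤ 1 + (a ^ 8)⁻¹ := by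
  rcases le_total a 1 with h | h
  · rw [min_eq_left h]
    linarith
  · rw [min_eq_right h, one_pow, inv_one]
    have : 0 ≤ (a ^ 8)⁻¹ := by positivity
    linarith

/-- **Deep-weak-coupling ceiling on the flowed response, UNIFORM IN THE VOLUME.**  For every compact `G`, every `r`,
every flow radius `ρ₀` and Schwartz weights `w, v` there is `K ≥ 0` with

  `|resp G r a ρ₀ w v β L| ≤ K · min(a(β),1)⁻⁸ · (1 + log β)/β`

for EVERY unit `a`, every `β ≥ 1` and every odd torus `2L+1 ≥ 3`.  Mechanism: `resp = Cov_T(X̂_w∘Θ₀, Ṽ_v)`;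
`|X̂_w| ≤ 64Nρ₀⁴ Σ_x|w(a x)| ≤ 64Nρ₀⁴ K_w/min(a,1)⁴` (flow unitarity + Schwartz lattice sums), `E_T|Ṽ_v − const| ≤
Σ_y |v(a y)|(6N − E_T dens_y) ≤ K_v/min(a,1)⁴ · 6K₀(1 + log β)/β` (the tree's volume-uniform mean-plaquette budget), and
`|Cov_T(F, V)| ≤ 2 sup|F| · E_T|V − b|`.  The gen-2 bound `abs_resp_le_weakCoupling` is the same with `(2L+1)⁸` in place of
`min(a,1)⁻⁸`; the present one does not degrade with `L` (on the admissible tori `a(β)L ≥ Λ₅` of the crux, `(2L+1)⁸ ≥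
(2Λ₅)⁸ a(β)⁻⁸`).  Nothing here is small on the physical unit `a ≍ e^{−β/(4Nb₀)}`. [folklore] -/
theorem abs_resp_le_weakCoupling_unif (ρ₀ : ℝ) (w v : SchwartzMap (EuclideanSpace ℝ (Fin 4)) ℝ) :
    ∃ K : ℝ, 0 ≤ K ∧ ∀ (a : ℝ → ℝ) (β : ℝ), 1 ≤ β → 0 < a β → ∀ L : ℕ, 1 ≤ L →
      |resp G r a ρ₀ w v β L| ≤ K * ((min (a β) 1) ^ 8)⁻¹ * ((1 + Real.log β) / β) := by
  obtain ⟨K₀, hK₀, hbud⟩ := exists_six_mul_sub_torusE_dens_le G r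
  obtain ⟨Kw, hKw0, hKw⟩ := exists_sum_abs_schwartz_lattice_le_div_min w
  obtain ⟨Kv, hKv0, hKv⟩ := exists_sum_abs_schwartz_lattice_le_div_min v
  refine ⟨2 * (ρ₀ ^ 4 * (64 * r.N) * Kw) * (Kv * (6 * K₀)), by positivity, fun a β hβ ha L hL => ?_⟩
  set m : ℝ := min (a β) 1 with hm_def
  have hm : 0 < m := lt_min ha one_pos
  set ℓ : ℝ := (1 + Real.log β) / β with hℓ_def
  have hℓ : 0 ≤ ℓ := div_nonneg (by linarith [Real.log_nonneg hβ]) (by linarith)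
  set Sw : ℝ := ∑ x ∈ box 4 L, |w (a β • siteToE x)| with hSw_def
  set Sv : ℝ := ∑ y ∈ box 4 L, |v (a β • siteToE y)| with hSv_def
  have hSw : Sw ≤ Kw / m ^ 4 := hKw (a β) ha (box 4 L)
  have hSv : Sv ≤ Kv / m ^ 4 := hKv (a β) ha (box 4 L)
  have hSv0 : 0 ≤ Sv := Finset.sum_nonneg fun _ _ => abs_nonneg _
  -- the response as a covariance against the reflected probe
  have hF : Continuous fun U : LGConfig 4 G => probe G r a ρ₀ w β L (cfgReflect U) :=
    (continuous_probe r a ρ₀ w β L).comp continuous_cfgReflect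
  have hK : ∀ U : LGConfig 4 G, |probe G r a ρ₀ w β L (cfgReflect U)| ≤ ρ₀ ^ 4 * (64 * r.N) * Sw :=
    fun U => abs_probe_le_sum r a ρ₀ w β L (cfgReflect U)
  have h1 := abs_torusCov_le G r β L hF (continuous_leg r a v β L) hK
    (6 * r.N * ∑ y ∈ box 4 L, v (a β • siteToE y))
  have h2 := torusE_abs_leg_sub_le_sum G r a v β L
  have h3 : ∑ y ∈ box 4 L, |v (a β • siteToE y)| * (6 * (r.N : ℝ) - torusE G r β L (dens G r y)) ≤
      Sv * (6 * K₀ * ℓ) := by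
    rw [hSv_def, Finset.sum_mul]
    refine Finset.sum_le_sum fun y _ => mul_le_mul_of_nonneg_left ?_ (abs_nonneg _)
    have := hbud L hL β hβ y
    rw [hℓ_def, ← mul_div_assoc]
    exact this
  have hA : ρ₀ ^ 4 * (64 * (r.N : ℝ)) * Sw ≤ ρ₀ ^ 4 * (64 * r.N) * (Kw / m ^ 4) :=
    mul_le_mul_of_nonneg_left hSw (by positivity)
  have hB : Sv * (6 * K₀ * ℓ) ≤ Kv / m ^ 4 * (6 * K₀ * ℓ) :=
    mul_le_mul_of_nonneg_right hSv (mul_nonneg (by positivity) hℓ)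
  have hB0 : 0 ≤ Sv * (6 * K₀ * ℓ) := mul_nonneg hSv0 (mul_nonneg (by positivity) hℓ)
  unfold resp
  rw [← torusE_comp_cfgReflect G r β L (probe G r a ρ₀ w β L)]
  calc |torusE G r β L (fun U => probe G r a ρ₀ w β L (cfgReflect U) * leg G r a v β L U) -
        torusE G r β L (fun V => probe G r a ρ₀ w β L (cfgReflect V)) * torusE G r β L (leg G r a v β L)|
      ≤ 2 * (ρ₀ ^ 4 * (64 * r.N) * Sw) *
          torusE G r β L (fun U => |leg G r a v β L U - 6 * r.N * ∑ y ∈ box 4 L, v (a β • siteToE y)|) := h1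
    _ ≤ 2 * (ρ₀ ^ 4 * (64 * r.N) * Sw) * (Sv * (6 * K₀ * ℓ)) :=
        mul_le_mul_of_nonneg_left (h2.trans h3) (by positivity)
    _ ≤ 2 * (ρ₀ ^ 4 * (64 * r.N) * (Kw / m ^ 4)) * (Kv / m ^ 4 * (6 * K₀ * ℓ)) :=
        mul_le_mul (mul_le_mul_of_nonneg_left hA (by norm_num)) hB hB0 (by positivity)
    _ = 2 * (ρ₀ ^ 4 * (64 * r.N) * Kw) * (Kv * (6 * K₀)) * (m ^ 8)⁻¹ * ℓ := by
        field_simp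

/-! ## §3 Slow units: the finite-size stub is free, the window stub is empty -/

/-- **On a slow unit the response dies UNIFORMLY IN THE VOLUME.**  If `(1 + log β)/(β a(β)⁸) → 0` (the unit decays slower
than `((1 + log β)/β)^{1/8}`), then for every `η > 0` there is `β₆` with `|resp(β, L)| ≤ η` for all `β ≥ β₆` and ALL odd
tori `2L+1 ≥ 3`. -/
theorem abs_resp_le_of_slowUnit {a : ℝ → ℝ} (ha : ∀ β, 0 < a β)
    (hslow : Tendsto (fun β => (1 + Real.log β) / (β * a β ^ 8)) atTop (𝓝 0))
    (ρ₀ : ℝ) (w v : SchwartzMap (EuclideanSpace ℝ (Fin 4)) ℝ) {η : ℝ} (hη : 0 < η) :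
    ∃ β₆ : ℝ, ∀ β : ℝ, β₆ ≤ β → ∀ L : ℕ, 1 ≤ L → |resp G r a ρ₀ w v β L| ≤ η := by
  obtain ⟨K, hK0, hK⟩ := abs_resp_le_weakCoupling_unif G r ρ₀ w v
  -- `(1 + log β)/β → 0`
  have hlim1 : Tendsto (fun β : ℝ => (1 + Real.log β) / β) atTop (𝓝 0) := by
    have h1 : Tendsto (fun β : ℝ => β⁻¹) atTop (𝓝 0) := tendsto_inv_atTop_zero
    have h2 : Tendsto (fun β : ℝ => Real.log β / β) atTop (𝓝 0) := by
      have h := Real.tendsto_pow_log_div_mul_add_atTop 1 0 1 one_ne_zero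
      refine h.congr fun y => ?_
      simp
    have h3 := h1.add h2
    rw [add_zero] at h3
    refine h3.congr' ?_
    filter_upwards [eventually_ne_atTop (0 : ℝ)] with β hβ
    rw [inv_eq_one_div, ← add_div]
  have hlim : Tendsto (fun β => K * ((1 + Real.log β) / β + (1 + Real.log β) / (β * a β ^ 8))) atTop (𝓝 0) := by
    have h := (hlim1.add hslow).const_mul K
    rwa [add_zero, mul_zero] at h
  obtain ⟨β₁, hβ₁⟩ := eventually_atTop.1 (hlim.eventually (eventually_le_nhds hη))
  refine ⟨max β₁ 1, fun β hβ L hL => ?_⟩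
  have hβ1 : β₁ ≤ β := le_trans (le_max_left _ _) hβ
  have hβone : 1 ≤ β := le_trans (le_max_right _ _) hβ
  have hβ0 : 0 < β := lt_of_lt_of_le one_pos hβone
  have haβ : 0 < a β := ha β
  have hℓ : 0 ≤ (1 + Real.log β) / β := div_nonneg (by linarith [Real.log_nonneg hβone]) hβ0.le
  have hb := hK a β hβone haβ L hL
  have hmin := inv_min_pow_le (a := a β) haβ
  calc |resp G r a ρ₀ w v β L| ≤ K * ((min (a β) 1) ^ 8)⁻¹ * ((1 + Real.log β) / β) := hb
    _ ≤ K * (1 + (a β ^ 8)⁻¹) * ((1 + Real.log β) / β) :=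
        mul_le_mul_of_nonneg_right (mul_le_mul_of_nonneg_left hmin hK0) hℓ
    _ = K * ((1 + Real.log β) / β + (1 + Real.log β) / (β * a β ^ 8)) := by
        field_simp
    _ ≤ η := hβ₁ β hβ1

/-- **THE FINITE-SIZE STUB IS FREE ON SLOW UNITS.**  For every compact `G`, every `r`, every unit with
`(1 + log β)/(β a(β)⁸) → 0`, every `ρ₀`, Schwartz `w, v` and `η > 0` — the conclusion of `FlowedResponseFiniteSize`
for these data: there are `Λ₆` (`= 1`), `β₆` with `|resp(β, L') − resp(β, L)| ≤ η` whenever `β ≥ β₆`, `Λ₆ ≤ a(β)L`,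
`L ≤ L'`.  (Both responses are `≤ η/2` by `abs_resp_le_of_slowUnit`; `a(β)L ≥ 1 > 0` forces `L ≥ 1`.)  So the registered
`stub_finiteSize` («W2 typed once», quantified over ALL units) has content only on the units that are not slow
(`liminf β a(β)⁸/(1 + log β) < ∞`) — a class containing, by `unit_pow_le_of_windowFloor`, every unit on which the window
stub can hold.  NOT a proof of `stub_finiteSize`. -/
theorem finiteSize_of_slowUnit {a : ℝ → ℝ} (ha : ∀ β, 0 < a β)
    (hslow : Tendsto (fun β => (1 + Real.log β) / (β * a β ^ 8)) atTop (𝓝 0))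
    (ρ₀ : ℝ) (w v : SchwartzMap (EuclideanSpace ℝ (Fin 4)) ℝ) {η : ℝ} (hη : 0 < η) :
    ∃ Λ₆ β₆ : ℝ, ∀ β : ℝ, β₆ ≤ β → ∀ L L' : ℕ, Λ₆ ≤ a β * L → L ≤ L' →
      |resp G r a ρ₀ w v β L' - resp G r a ρ₀ w v β L| ≤ η := by
  obtain ⟨β₆, hβ₆⟩ := abs_resp_le_of_slowUnit G r ha hslow ρ₀ w v (half_pos hη)
  refine ⟨1, β₆, fun β hβ L L' hL hLL' => ?_⟩
  have hL1 : 1 ≤ L := by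
    rcases Nat.eq_zero_or_pos L with h | h
    · subst h
      simp only [Nat.cast_zero, mul_zero] at hL
      linarith
    · exact h
  have hL'1 : 1 ≤ L' := hL1.trans hLL'
  have h1 := hβ₆ β hβ L hL1
  have h2 := hβ₆ β hβ L' hL'1
  calc |resp G r a ρ₀ w v β L' - resp G r a ρ₀ w v β L|
      ≤ |resp G r a ρ₀ w v β L'| + |resp G r a ρ₀ w v β L| := abs_sub _ _
    _ ≤ η / 2 + η / 2 := add_le_add h2 h1
    _ = η := by ring

/-- **The finite-size statement restricted to slow units, in the binder shape of `FlowedResponseFiniteSize`** (every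
compact `G` — simplicity, `a → 0` and `ρ₀ > 0` are not needed): a literal sub-case of the registered stub, proved. -/
theorem flowedResponseFiniteSize_slowUnits :
    ∀ (G : Type) [Group G] [TopologicalSpace G] [IsTopologicalGroup G] [CompactSpace G],
      letI : MeasurableSpace G := borel G
      haveI : BorelSpace G := ⟨rfl⟩
      ∀ (r : LatticeRep G) (a : ℝ → ℝ), (∀ β, 0 < a β) →
        Tendsto (fun β => (1 + Real.log β) / (β * a β ^ 8)) atTop (𝓝 0) →
        ∀ (ρ₀ : ℝ) (w v : SchwartzMap (EuclideanSpace ℝ (Fin 4)) ℝ) (η : ℝ), 0 < η →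
          ∃ Λ₆ β₆ : ℝ, ∀ β : ℝ, β₆ ≤ β → ∀ L L' : ℕ, Λ₆ ≤ a β * L → L ≤ L' →
            |resp G r a ρ₀ w v β L' - resp G r a ρ₀ w v β L| ≤ η := by
  intro G _ _ _ _
  letI : MeasurableSpace G := borel G
  haveI : BorelSpace G := ⟨rfl⟩
  intro r a ha hslow ρ₀ w v η hη
  exact finiteSize_of_slowUnit G r ha hslow ρ₀ w v hη

/-- **THE WINDOW STUB IS EMPTY ON SLOW UNITS** (gen-2 pinning, contrapositive form).  If `a → 0` is slow
(`(1 + log β)/(β a(β)⁸) → 0`), then `(r, a)` carries the femto-window floor data of `stub_window` at NO radius: for every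
`ρ₀, w, v, ε₁ > 0, β₅, Λ₅` the window clause `∀ Λ₆ ∃ β₆ …` fails.  (`unit_pow_le_of_windowFloor` gives
`a(β)⁸ ≤ C(1 + log β)/β`, i.e. `1 ≤ C(1 + log β)/(β a(β)⁸) → 0`.)  Together with `finiteSize_of_slowUnit`: on slow units
the skeleton's two stubs are (vacuously false, trivially true); all content of BOTH sits on the pinned units. -/
theorem windowFloor_false_of_slowUnit {a : ℝ → ℝ} (ha : ∀ β, 0 < a β) (ha0 : Tendsto a atTop (𝓝 0))
    (hslow : Tendsto (fun β => (1 + Real.log β) / (β * a β ^ 8)) atTop (𝓝 0))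
    {ρ₀ ε₁ β₅ Λ₅ : ℝ} {w v : SchwartzMap (EuclideanSpace ℝ (Fin 4)) ℝ} (hε : 0 < ε₁)
    (hwin : ∀ Λ₆ : ℝ, ∃ β₆ : ℝ, ∀ β : ℝ, β₅ ≤ β → β₆ ≤ β → ∀ L : ℕ, Λ₅ ≤ a β * L → a β * L ≤ Λ₆ →
      ε₁ ≤ |resp G r a ρ₀ w v β L|) : False := by
  obtain ⟨C, β₀, hC0, hC⟩ := unit_pow_le_of_windowFloor G r ha ha0 hε hwin
  have hlim : Tendsto (fun β => C * ((1 + Real.log β) / (β * a β ^ 8))) atTop (𝓝 0) := by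
    have h := hslow.const_mul C
    rwa [mul_zero] at h
  obtain ⟨β₁, hβ₁⟩ := eventually_atTop.1 (hlim.eventually (eventually_le_nhds one_half_pos))
  set β : ℝ := max (max β₀ β₁) 1 with hβ_def
  have hβ0 : β₀ ≤ β := le_trans (le_max_left _ _) (le_max_left _ _)
  have hβ1 : β₁ ≤ β := le_trans (le_max_right _ _) (le_max_left _ _)
  have hβone : 1 ≤ β := le_max_right _ _
  have hβpos : 0 < β := lt_of_lt_of_le one_pos hβone
  have ha8 : 0 < a β ^ 8 := pow_pos (ha β) 8
  have h1 : a β ^ 8 ≤ C * (1 + Real.log β) / β := hC β hβ0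
  have h2 : C * ((1 + Real.log β) / (β * a β ^ 8)) ≤ 1 / 2 := hβ₁ β hβ1
  have h3 : (1 : ℝ) ≤ C * ((1 + Real.log β) / (β * a β ^ 8)) := by
    have e : C * ((1 + Real.log β) / (β * a β ^ 8)) = (C * (1 + Real.log β) / β) / a β ^ 8 := by
      field_simp
    rw [e, le_div_iff₀ ha8, one_mul]
    exact h1
  linarith

/-- **Power laws slower than `β^{-1/8}` are slow units**: for `c < 1/8`, `(1 + log β)/(β (β^{-c})⁸) → 0`.  So no
`a(β) = κ β^{-c}`-type unit (`c < 1/8`) — a fortiori no logarithmic unit — is a witness of `stub_window` or of the crux,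
while each of them satisfies the finite-size stub's conclusion. [folklore] -/
theorem isSlowUnit_rpow {c : ℝ} (hc : c < 1 / 8) :
    Tendsto (fun β : ℝ => (1 + Real.log β) / (β * (β ^ (-c)) ^ 8)) atTop (𝓝 0) := by
  have hs : 0 < 1 - 8 * c := by linarith
  have h1 : (fun _ : ℝ => (1 : ℝ)) =o[atTop] fun β : ℝ => β ^ (1 - 8 * c) := by
    refine (Asymptotics.isLittleO_const_left).2 (Or.inr ?_)
    exact tendsto_norm_atTop_atTop.comp (tendsto_rpow_atTop hs)
  have h2 : Real.log =o[atTop] fun β : ℝ => β ^ (1 - 8 * c) := isLittleO_log_rpow_atTop hs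
  have h3 := (h1.add h2).tendsto_div_nhds_zero
  refine h3.congr' ?_
  filter_upwards [eventually_gt_atTop (0 : ℝ)] with β hβ
  have e : β * (β ^ (-c)) ^ 8 = β ^ (1 - 8 * c) := by
    rw [← Real.rpow_mul_natCast hβ.le, show (-c) * ((8 : ℕ) : ℝ) = -(8 * c) by push_cast; ring,
      ← Real.rpow_one_add' hβ.le (by linarith)]
    ring_nf
  rw [e]

end Uniform

end Summit.QuantumFields.YangMills.Cruxes.FlowedResponseFloor.WindowSplit

end
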